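/-
Copyright (c) 2026 the pub-hodgecm-mathlib formalisation cell (harness21).  Prover seat hodgecm-mathlib-K2E1-p15 (g4) ((V) OF RECORD KEEPER, Track B ∕ K2-LIT), h413 = `stmt-HodgeConjecture-24833`, route
`HCCMUnconditional`, R90-TF section S8 «ContSpec-n½», deal S8-R252 ((V) ED. 15 = `hMS32` DISCHARGED modulo the core): the payer of the (MS-3∕2) letter `hMS32` of the (V) OF RECORD at the
NAMED witness family, from the unfolding letter `hunfK` alone — the 3∕2 twin of ★ p864973 `K2E1ChiAxisRealityOfRecordCMThree` §3 and ★ p864823 `hqa_of_eulerFactorisation`.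
-/
import Summits.HodgeConjecture.HodgeConjecture.Theorems.K2E1ChiAxisRealityOfRecordCMThree             -- ★ p864973 (this seat): `hreal_midWitness`, `im_wc_eq_zero_of_exports_free`; brings ★ p864687 (L2) of record + §2, ★ OFF-AXIS, ★ p862892, ★ TUBE-FREE
import Summits.HodgeConjecture.HodgeConjecture.Theorems.K2E1ChiScatteringCoordsEulerFactorisationCMThree -- ★ p864823 (K2E2-p12): `exists_eulerFactorisation_midWitness`; brings ★ F4 CM `exists_differentiableOn_mul_chiScalar_cm_three`, ★ `K2E1ConvexDiffCountableConnected`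
import Summits.HodgeConjecture.HodgeConjecture.Theorems.K2E1ChiEisensteinL2BoundMiddlePoleCMThree        -- ★ p863403 (K2E1-p16): `msBound_middlePole_of_chiRelation` (the three-scalar (MS-3∕2) bound)
import HarnessLib

/-!
# h413 ∕ R90-S8 — `K2E1ChiMS32OfUnfoldingCMThree`: THE (MS-3∕2) LETTER `hMS32` OF THE (V) OF RECORD AT THE NAMED WITNESS FAMILY, FROM THE UNFOLDING LETTER `hunfK` ALONE —
# `∀ T ≥ 1, ∃ C, ∀ᶠ z in 𝓝[≠] 3∕2, ‖z − 3∕2‖·‖Λ^T(midWitnessEc z)‖_{L²} ≤ C`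

Cell `pub/hodgecm-mathlib`, crux h413 = `stmt-HodgeConjecture-24833`, route `HCCMUnconditional`; R90-TF section S8, deal S8-R252; (V) OF RECORD letter `hMS32` (ED. 13 ∕ 14 binder).  THEOREMS
ONLY (no `def`, no `instance`, no notation, no named-fact hypothesis, no `sorry`; default heartbeats); lane `--supports stmt-HodgeConjecture-24833 --as helper` (count-neutral).  Closes no socket.

THE MATHEMATICS ([MoeglinWaldspurger1995, IV.1.10–IV.1.11, IV.2.3, IV.3.12 (a)]; [Langlands1976, §6–§7]; [BernsteinLapid2019, §4]).  At the middle point `z₀ = 3∕2` the truncated χ-Eisenstein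
family has at most a SIMPLE pole in `L²`: ★ p863403 `msBound_middlePole_of_chiRelation` bounds `‖(z − 3∕2)•F_T z‖` near `3∕2` from the three-scalar diagonal Maass–Selberg relation
(`hMSrel`), the simple-pole data of the cross scalar (`hd`, `hdw`: `(z − 3∕2)·wc` extends analytically), its axis reality (`hreal`), and the double-pole bound of the kernel (`hβ`:
`|z − 3∕2|²·Bc z z` bounded).  At the NAMED witness family ALL FIVE are now theorems of the frame and of the one unfolding letter `hunfK`: `hMSrel` is letter-free (★ TUBE-FREE uniform
constants + the tube agreements of ★ p864687's (L2) of record + ★ p862892/p864494 `msRel_of_tube_letters_at (3∕2)` on ★ `quarterDomains_of_codiscrete`); `hreal` is ★ p864973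
`hreal_midWitness` propagated to the punctured real trace (★ `eventually_im_eq_zero_of_real_offPoles`); and the pole data come from ★ p864823's Euler factorisation: on the connected
`D = {1 < Re} ∖ P`, `(z−2)(2z−3)·qc_j(z) = G(z)·a_j(z)` (★ `exists_eulerFactorisation_midWitness` + ★ F4 `(z−2)(2z−3)·cS = G` + identity theorem), so `dq_j := G·a_j∕(2(z−2))` is
ANALYTIC AT `3∕2` and equals `(z − 3∕2)·qc_j` on the punctured neighbourhood (no `hφ1`: one divides by `z − 2 ≠ 0`), whence `d := (Σ_j dq_j·⟨bV_j, φ⟩_K)·[η]` and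
`|z−3∕2|²·Bc z z = κ·Σ_{j,l} dq_j·conj dq_l·G_jl` (continuous at `3∕2`, hence bounded).  Finally `‖(z − 3∕2)•Fam z‖ = ‖z − 3∕2‖·‖Λ^T(midWitnessEc z)‖_{L²(μ)}` off `P` (★ `hE6_midWitness`).
* §1 `exists_simplePole_of_coords_formula`, `exists_sqPole_kernelDiag_of_coords` — the pole data of the closed formulas from per-coordinate simple-pole data (generic, finite index).
* §2 HEAD **`hMS32_midWitness_of_unfolding`** — the `hMS32` binder of ★ p864963 ∕ ★ p865042 (ED. 13 ∕ 14) BYTE FOR BYTE over the spec's binders, the Maass–Selberg extras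
  `μK νI 𝓕I h𝓕I h𝓕1 hχ₁ hρ₁`, ★ F4's frame `(hφL hφA hS hurφ hηu hηA hT hurη)`, and the ONE letter `hunfK` (★ p864823's bytes).
HONEST LABEL: HC_CM is proved only modulo the 7 printed citations (2 remaining named inputs: hLiu418 = `stmt-HodgeConjecture-24832`, h413 = `stmt-HodgeConjecture-24833`) until rung 0
closes; this file asserts no named fact and closes no socket; `hMS32` becomes ★ MODULO `hunfK` (the (W)-core's readings); SOCKET DIGITS 0∕8; REL ≠ ★ ≠ BUILT; count-neutral.

## References
* [MoeglinWaldspurger1995] C. Mœglin, J.-L. Waldspurger, *Spectral Decomposition and Eisenstein Series* (1995), IV.1.10–IV.1.11, IV.2.3, IV.3.12 (a).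
* [Langlands1976] R. P. Langlands, *On the Functional Equations Satisfied by Eisenstein Series*, LNM 544 (1976), §6–§7.
* [BernsteinLapid2019] J. Bernstein, E. Lapid, *On the meromorphic continuation of Eisenstein series*, J. AMS 37 (2024), Thm 2.3, §4.
-/

set_option autoImplicit false
set_option linter.dupNamespace false  -- the mandated namespace repeats the summit's segment (`HodgeConjecture.HodgeConjecture`)

noncomputable section

open MeasureTheory Measure NumberField IsDedekindDomain Set Filter Topology Complex
open scoped ENNReal NNReal ComplexConjugate InnerProductSpace
open Literature.MeasureTheory.Group Literature.NumberTheory Literature.NumberTheory.Automorphic Literature.NumberTheory.Automorphic.UnitaryGroup Literature.NumberTheory.GaloisRepresentations AdelicGroupData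
open Literature.NumberTheory.Automorphic.Arthur2013.Leaves.TECR Literature.NumberTheory.Rogawski1990 Literature.NumberTheory.LFunctions
open Summit.HodgeConjecture.HodgeConjecture.Cruxes.H413.K2E1BorelEisensteinU Summit.HodgeConjecture.HodgeConjecture.Cruxes.H413.K2E1CharacterEisensteinU2Defs
open Summit.HodgeConjecture.HodgeConjecture.Cruxes.H413.K2E1CharacterEisensteinU3PairDefs Summit.HodgeConjecture.HodgeConjecture.Cruxes.H413.K2E1BLBorelSpacesU2Defs
open Summit.HodgeConjecture.HodgeConjecture.Cruxes.H413.K2E1ChiSectionSpaceU2Defs (chiSectionSpace isChiSection_of_mem)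
open Summit.HodgeConjecture.HodgeConjecture.Cruxes.H413.K2E1ChiMaassSelbergDiagonalCMThree (normSq_family_eq_chiFourTerm_of_tube normSq_family_eq_chiFourTerm_lower_of_tube)
open Summit.HodgeConjecture.HodgeConjecture.Cruxes.H413.K2E1ChiMaassSelbergTubeFreeCMThree (chiTube_threeScalars_uniform_free)
open Summit.HodgeConjecture.HodgeConjecture.Cruxes.H413.K2E1ChiEisensteinRealAxisPoleLedgerOfExportsCMThree (quarterDomains_of_codiscrete)
open Summit.HodgeConjecture.HodgeConjecture.Cruxes.H413.K2E1ChiMaassSelbergPoleExclusionOffAxisCMThree (msRel_of_tube_letters_at eventually_mem_quarterDomains_of_codiscrete)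
open Summit.HodgeConjecture.HodgeConjecture.Cruxes.H413.K2E1ChiMaassSelbergOnAxisScalarsOfRecordCMThree (exists_scalars_of_coords_global continuousAt_kernelDiag_of_coords
  exists_eventually_norm_le_of_continuousAt eventually_im_eq_zero_of_real_offPoles)
open Summit.HodgeConjecture.HodgeConjecture.Cruxes.H413.K2E1ChiTruncatedFamilyTransportCMThree (hE6_midWitness)
open Summit.HodgeConjecture.HodgeConjecture.Cruxes.H413.R90S8ResGMidBlockScatteringOfRecordU3 (integrable_restrict_mul_conj_of_bounded)
open Summit.HodgeConjecture.HodgeConjecture.Cruxes.H413.K2E1ChiEisensteinMeromorphicExportsM1CMThree (one_apply_torus isAutomorphic_one)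
open Summit.HodgeConjecture.HodgeConjecture.Cruxes.H413.K2E1ChiScatteringCoordsEulerFactorisationCMThree (exists_eulerFactorisation_midWitness)
open Summit.HodgeConjecture.HodgeConjecture.Cruxes.H413.K2E1ChiIntertwiningScalarEulerQuotientU3CM (exists_differentiableOn_mul_chiScalar_cm_three)
open Summit.HodgeConjecture.HodgeConjecture.Cruxes.H413.K2E1ConvexDiffCountableConnected (isPreconnected_convex_diff_of_countable countable_of_codiscrete)
open Summit.HodgeConjecture.HodgeConjecture.Cruxes.H413.K2E1ChiEisensteinL2BoundMiddlePoleCMThree (msBound_middlePole_of_chiRelation)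
open Summit.HodgeConjecture.HodgeConjecture.Cruxes.H413.K2E1ChiAxisRealityOfRecordCMThree (hreal_midWitness)
open Summit.HodgeConjecture.HodgeConjecture.R90.S8 (midWitnessEc midWitnessP midWitnessQc midWitnessQ midWitnessExports_spec)

namespace Summit.HodgeConjecture.HodgeConjecture.Cruxes.H413.K2E1ChiMS32OfUnfoldingCMThree

/-! ## §1 Pole data of the closed formulas from per-coordinate simple-pole data -/

section Coords

variable {ι : Type} [Fintype ι]

/-- **SIMPLE POLE OF THE CROSS SCALAR**: if every coordinate `qc_j` has `dq_j` analytic at `z₀` with `dq_j = (z − z₀)·qc_j` on the punctured neighbourhood, then the closed-formula scalar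
`wc z = (Σ_j qc_j z·G_j)·c` has `d := (Σ_j dq_j·G_j)·c` analytic at `z₀` with `d = (z − z₀)·wc` there (the letters `hd`, `hdw` of ★ `msBound_of_chiRelation`). [cite: BernsteinLapid2019, §4 p. 10] -/
theorem exists_simplePole_of_coords_formula {qc dq : ι → ℂ → ℂ} {z₀ : ℂ} (hdq : ∀ j, AnalyticAt ℂ (dq j) z₀) (heq : ∀ j, ∀ᶠ z in 𝓝[≠] z₀, dq j z = (z - z₀) * qc j z)
    (G : ι → ℂ) (c : ℂ) {wc : ℂ → ℂ} (hwc : ∀ z : ℂ, wc z = (∑ j, qc j z * G j) * c) :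
    ∃ d : ℂ → ℂ, AnalyticAt ℂ d z₀ ∧ ∀ᶠ z in 𝓝[≠] z₀, d z = (z - z₀) * wc z := by
  refine ⟨fun z => (∑ j, dq j z * G j) * c, (Finset.analyticAt_fun_sum Finset.univ fun j _ => (hdq j).mul analyticAt_const).mul analyticAt_const, ?_⟩
  filter_upwards [eventually_all.2 heq] with z hz
  have hs : ∑ j, dq j z * G j = (z - z₀) * ∑ j, qc j z * G j := by
    rw [Finset.mul_sum]
    exact Finset.sum_congr rfl fun j _ => by rw [hz j]; ring
  rw [hwc, hs, mul_assoc]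

/-- **DOUBLE POLE OF THE DIAGONAL KERNEL**: under the same per-coordinate data, the closed-formula kernel `Bc s s′ = κ·Σ_{j,l} qc_j(s)·conj qc_l(s′)·G_{jl}` satisfies
`‖z − z₀‖²·‖Bc z z‖ ≤ B` on the punctured neighbourhood (`(z−z₀)·conj(z−z₀)·Bc z z = κ·Σ dq_j·conj dq_l·G_jl`, continuous at `z₀`) — the letter `hβ` of ★ `msBound_of_chiRelation`.
[cite: BernsteinLapid2019, §4 p. 10] -/
theorem exists_sqPole_kernelDiag_of_coords {qc dq : ι → ℂ → ℂ} {z₀ : ℂ} (hdq : ∀ j, AnalyticAt ℂ (dq j) z₀) (heq : ∀ j, ∀ᶠ z in 𝓝[≠] z₀, dq j z = (z - z₀) * qc j z)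
    (κ : ℂ) (G : ι → ι → ℂ) {Bc : ℂ → ℂ → ℂ} (hBc : ∀ s s' : ℂ, Bc s s' = κ * ∑ j, ∑ l, qc j s * conj (qc l s') * G j l) :
    ∃ B : ℝ, ∀ᶠ z in 𝓝[≠] z₀, ‖z - z₀‖ ^ 2 * ‖Bc z z‖ ≤ B := by
  obtain ⟨B, hB⟩ := exists_eventually_norm_le_of_continuousAt (continuousAt_kernelDiag_of_coords hdq κ G)
  refine ⟨B, ?_⟩
  filter_upwards [hB, eventually_all.2 heq] with z hz hzq
  have hkey : (z - z₀) * conj (z - z₀) * Bc z z = κ * ∑ j, ∑ l, dq j z * conj (dq l z) * G j l := by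
    rw [hBc]
    simp only [Finset.mul_sum, hzq, map_mul]
    exact Finset.sum_congr rfl fun j _ => Finset.sum_congr rfl fun l _ => by ring
  have hn : ‖z - z₀‖ ^ 2 * ‖Bc z z‖ = ‖(z - z₀) * conj (z - z₀) * Bc z z‖ := by
    rw [norm_mul, norm_mul, RCLike.norm_conj, sq]
  rw [hn, hkey]
  exact hz

end Coords

/-! ## §2 HEAD: `hMS32` at the named witness family, of the unfolding letter -/

section OfRecord
variable (L : Type) [Field L] [NumberField L] [IsCMField L] [MeasurableSpace (quasiSplit (↥(maximalRealSubfield L)) L (IsCMField.complexConj L) 3).Adelic] [BorelSpace (quasiSplit (↥(maximalRealSubfield L)) L (IsCMField.complexConj L) 3).Adelic]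
  [MeasurableSpace (arch (↥(maximalRealSubfield L)) L (IsCMField.complexConj L) 3 ((StdForm.antidiagonal 3).over L))] [BorelSpace (arch (↥(maximalRealSubfield L)) L (IsCMField.complexConj L) 3 ((StdForm.antidiagonal 3).over L))]
  [MeasurableSpace (finAdelic (↥(maximalRealSubfield L)) L (IsCMField.complexConj L) 3 ((StdForm.antidiagonal 3).over L))] [BorelSpace (finAdelic (↥(maximalRealSubfield L)) L (IsCMField.complexConj L) 3 ((StdForm.antidiagonal 3).over L))]
  [MeasurableSpace (AdeleRing (𝓞 L) L)ˣ] [BorelSpace (AdeleRing (𝓞 L) L)ˣ]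

/-- **HEAD — THE (MS-3∕2) LETTER `hMS32` OF THE (V) OF RECORD, OF THE UNFOLDING LETTER `hunfK`**: at the NAMED witness family (★ `midWitnessExports_spec`'s binders VERBATIM) with the
Maass–Selberg frame extras, ★ F4's frame for the partial `L`-ratio `cS` and `hunfK` (★ p864823's bytes): for every level `T ≥ 1`,
`∃ C, ∀ᶠ z in 𝓝[≠] 3∕2, ‖z − 3∕2‖·(eLpNorm (quotFun (Λ^T (midWitnessEc z))) 2 μ).toReal ≤ C` — the `hMS32` binder of ★ p864963 ∕ ★ p865042 BYTE FOR BYTE.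
[cite: MoeglinWaldspurger1995, IV.1.10–IV.1.11, IV.2.3, IV.3.12 (a)] [cite: Langlands1976, §6–§7] [cite: BernsteinLapid2019, Thm 2.3, §4] -/
theorem hMS32_midWitness_of_unfolding
    (μ : Measure (quasiSplit (↥(maximalRealSubfield L)) L (IsCMField.complexConj L) 3).automorphicQuotient) [(quasiSplit (↥(maximalRealSubfield L)) L (IsCMField.complexConj L) 3).IsAutomorphicMeasure μ]
    (νG : Measure (quasiSplit (↥(maximalRealSubfield L)) L (IsCMField.complexConj L) 3).Adelic) [νG.IsHaarMeasure] [νG.IsInvInvariant] [SFinite νG]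
    (ν : Measure ↥(adelicUnipotent (↥(maximalRealSubfield L)) L (IsCMField.complexConj L) 3)) [ν.IsHaarMeasure] [ν.IsMulRightInvariant] [ν.IsInvInvariant]
    {𝓕 : Set ↥(adelicUnipotent (↥(maximalRealSubfield L)) L (IsCMField.complexConj L) 3)}
    (h𝓕N : IsFundamentalDomain ↥(rationalUnipotent (↥(maximalRealSubfield L)) L (IsCMField.complexConj L) 3) 𝓕 ν) (h𝓕c : IsCompact (closure 𝓕)) (h𝓕₀ : ν 𝓕 ≠ 0)
    {β : (quasiSplit (↥(maximalRealSubfield L)) L (IsCMField.complexConj L) 3).Adelic → ℝ≥0∞}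
    (hβ : IsCoveringWeight ↥((arithmeticBorel (↥(maximalRealSubfield L)) L (IsCMField.complexConj L) 3).map (quasiSplit (↥(maximalRealSubfield L)) L (IsCMField.complexConj L) 3).arithmeticSubgroup.subtype) β)
    {μZ : Measure (borelQuotient (↥(maximalRealSubfield L)) L (IsCMField.complexConj L) 3)} [SFinite μZ]
    (hμZ : ∀ f : borelQuotient (↥(maximalRealSubfield L)) L (IsCMField.complexConj L) 3 → ℝ≥0∞, Measurable f → ∫⁻ z, f z ∂μZ = ∫⁻ g, β g * f (toBorelQuotient (↥(maximalRealSubfield L)) L (IsCMField.complexConj L) 3 g) ∂νG)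
    -- the M1 family: `φ ∈ V(χ, K, 1)` continuous bounded with `φ ∘ ι_∞ = φ(1)`, and a basis of `V(χʷ, K, 1)` by continuous bounded functions
    {χ : HeckeCharacter L} {K' : Subgroup (quasiSplit (↥(maximalRealSubfield L)) L (IsCMField.complexConj L) 3).Adelic} {ω : ↥K' → ℂ} {φ : (quasiSplit (↥(maximalRealSubfield L)) L (IsCMField.complexConj L) 3).Adelic → ℂ} (hφV : φ ∈ chiSectionSpace χ K' ω) (hφc : Continuous φ) {Mφ : ℝ} (hφM : ∀ x, ‖φ x‖ ≤ Mφ)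
    -- the LEVEL: `K′ ≤ K`, `ι(K_∞) ⊆ K′`, an open compact `U₀` with `ι_f(U₀ ∩ G_f) ⊆ K′` on which `ω = 1`, continuity of the sections; auxiliary Haar measures on `G_∞` (two-sided) and `G(𝔸_f)`
    (hK' : K' ≤ ((standardMaximalCompactGL 3 L).comap (adelicVal (↥(maximalRealSubfield L)) L (IsCMField.complexConj L) 3 ((StdForm.antidiagonal 3).over L)) : Subgroup (quasiSplit (↥(maximalRealSubfield L)) L (IsCMField.complexConj L) 3).Adelic))
    (hKinf : ∀ k : arch (↥(maximalRealSubfield L)) L (IsCMField.complexConj L) 3 ((StdForm.antidiagonal 3).over L), adelicVal (↥(maximalRealSubfield L)) L (IsCMField.complexConj L) 3 ((StdForm.antidiagonal 3).over L) (archToAdelic (↥(maximalRealSubfield L)) L (IsCMField.complexConj L) 3 _ k) ∈ standardMaximalCompactGL 3 L →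
      archToAdelic (↥(maximalRealSubfield L)) L (IsCMField.complexConj L) 3 _ k ∈ K')
    (U₀ : Subgroup (GL (Fin 3) (FiniteAdeleRing (𝓞 L) L))) (hU₀o : IsOpen (U₀ : Set (GL (Fin 3) (FiniteAdeleRing (𝓞 L) L)))) (hU₀c : IsCompact (U₀ : Set (GL (Fin 3) (FiniteAdeleRing (𝓞 L) L))))
    (hU : ∀ b : finAdelic (↥(maximalRealSubfield L)) L (IsCMField.complexConj L) 3 ((StdForm.antidiagonal 3).over L), (b : GL (Fin 3) (FiniteAdeleRing (𝓞 L) L)) ∈ U₀ →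
      ∃ hb : finAdelicToAdelic (↥(maximalRealSubfield L)) L (IsCMField.complexConj L) 3 ((StdForm.antidiagonal 3).over L) b ∈ K', ω ⟨_, hb⟩ = 1)
    (hVc : ∀ φ ∈ chiSectionSpace χ K' ω, Continuous φ)
    (μa : Measure (arch (↥(maximalRealSubfield L)) L (IsCMField.complexConj L) 3 ((StdForm.antidiagonal 3).over L))) [μa.IsHaarMeasure] [μa.IsMulRightInvariant]
    (μf : Measure (finAdelic (↥(maximalRealSubfield L)) L (IsCMField.complexConj L) 3 ((StdForm.antidiagonal 3).over L))) [μf.IsHaarMeasure]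
    {ι' : Type} [Fintype ι'] [DecidableEq ι'] (bV : Module.Basis ι' ℂ ↥(chiSectionSpace (reflectChar (IsCMField.complexConj L) χ) K' ω))
    (hbc : ∀ j, Continuous ((bV j : ↥(chiSectionSpace (reflectChar (IsCMField.complexConj L) χ) K' ω)) : (quasiSplit (↥(maximalRealSubfield L)) L (IsCMField.complexConj L) 3).Adelic → ℂ)) {Mb : ℝ} (hbM : ∀ j x, ‖((bV j : ↥(chiSectionSpace (reflectChar (IsCMField.complexConj L) χ) K' ω)) : (quasiSplit (↥(maximalRealSubfield L)) L (IsCMField.complexConj L) 3).Adelic → ℂ) x‖ ≤ Mb)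
    (h2 : Module.finrank (↥(maximalRealSubfield L)) L = 2) (hc : IsCMField.complexConj L ≠ 1) (hJ : ((StdForm.antidiagonal 3).over L).det ≠ 0)
    (ψ : ↥(TorusDict.torus (IsCMField.complexConj L)) →ₜ* ℂˣ) (hψ : TorusDict.IsAutomorphic (IsCMField.complexConj L) ψ)
    (h𝓕1 : ν 𝓕 = 1)
    -- the Maass–Selberg frame extras
    (μK : Measure ((standardMaximalCompactGL 3 L).comap (adelicVal (↥(maximalRealSubfield L)) L (IsCMField.complexConj L) 3 ((StdForm.antidiagonal 3).over L)) : Subgroup (quasiSplit (↥(maximalRealSubfield L)) L (IsCMField.complexConj L) 3).Adelic))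
    [μK.IsHaarMeasure]
    (νI : Measure (AdeleRing (𝓞 L) L)ˣ) [νI.IsHaarMeasure]
    {𝓕I : Set (AdeleRing (𝓞 L) L)ˣ} (h𝓕I : IsIdeleClassDomain L 𝓕I)
    (hχ₁ : χ.IsUnitary) (hρ₁ : ∀ r : ℝ≥0ˣ, χ (posRealIdele L r) = 1)
    -- ★ F4's frame for the partial `L`-ratio `cS`
    {φL : HeckeCharacter L} {η : HeckeCharacter ↥(maximalRealSubfield L)} {S : Set (HeightOneSpectrum (𝓞 L))} {T : Set (HeightOneSpectrum (𝓞 ↥(maximalRealSubfield L)))}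
    (hφL : φL.IsUnitary) (hφA : ∀ t : ℝ≥0ˣ, φL (posRealIdele L t) = 1) (hS : S.Finite) (hurφ : ∀ w ∉ S, φL.IsUnramifiedAt w)
    (hηu : η.IsUnitary) (hηA : ∀ t : ℝ≥0ˣ, η (posRealIdele ↥(maximalRealSubfield L) t) = 1) (hT : T.Finite) (hurη : ∀ v ∉ T, η.IsUnramifiedAt v)
    -- THE LETTER: the per-base-point Euler factorisation on `K_max`
    -- THE LETTER: the per-base-point Euler factorisation on `K_max`
    (hunfK : ∀ k : (quasiSplit (↥(maximalRealSubfield L)) L (IsCMField.complexConj L) 3).Adelic, adelicVal (↥(maximalRealSubfield L)) L (IsCMField.complexConj L) 3 ((StdForm.antidiagonal 3).over L) k ∈ standardMaximalCompactGL 3 L →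
      ∃ A : ℂ → ℂ, DifferentiableOn ℂ A {z : ℂ | 1 < z.re} ∧ ∀ z : ℂ, 2 < z.re →
        (∫ v : ↥(adelicUnipotent (↥(maximalRealSubfield L)) L (IsCMField.complexConj L) 3), flatSectionU φ z ((quasiSplit (↥(maximalRealSubfield L)) L (IsCMField.complexConj L) 3).toAdelic (weylLongU ((IsCMField.complexConj L : L ≃ₐ[↥(maximalRealSubfield L)] L) : L →+* L) (rfl : (StdForm.antidiagonal 3).over L = (StdForm.antidiagonal 3).over L)) * ((v : (quasiSplit (↥(maximalRealSubfield L)) L (IsCMField.complexConj L) 3).Adelic) * k)) ∂ν) = ((partialStandardL S (fun w => {φL.valueAtUniformizer w}) (z - 1) * partialStandardL T (fun v => {η.valueAtUniformizer v}) (2 * z - 2)) /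
            (partialStandardL S (fun w => {φL.valueAtUniformizer w}) z * partialStandardL T (fun v => {η.valueAtUniformizer v}) (2 * z - 1))) * A z) :
    ∀ T : ℝ≥0, 1 ≤ T →
      ∃ C : ℝ, ∀ᶠ z in 𝓝[≠] ((3 : ℂ) / 2), ‖z - (3 : ℂ) / 2‖ * (eLpNorm ((quasiSplit (↥(maximalRealSubfield L)) L (IsCMField.complexConj L) 3).quotFun (truncation ν 𝓕 T (midWitnessEc L μ νG ν h𝓕N h𝓕c h𝓕₀ hβ hμZ hφV hφc hφM hK' hKinf U₀ hU₀o hU₀c hU hVc μa μf bV hbc hbM h2 hc hJ ψ hψ z))) 2 μ).toReal ≤ C := by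
  intro T' hT'
  have hT0 : (0 : ℝ) < (T' : ℝ) := by exact_mod_cast (zero_lt_one.trans_le hT')
  -- the spec's clauses: 2 `hqφ`, 5 tube identity, 6 `qc = q` on the tube, 7 closed, 8 co-discrete, 9 candidates' real parts, 11 `qc` analytic off `P`, 13 `qc` holomorphic off `P`
  obtain ⟨-, hqφ, -, -, hE2, hqcq, hPc, hPcd, hPre, -, hqan, -, hqcP, -, -, -⟩ := midWitnessExports_spec L μ νG ν h𝓕N h𝓕c h𝓕₀ hβ hμZ hφV hφc hφM hK' hKinf U₀ hU₀o hU₀c hU hVc μa μf bV hbc hbM h2 hc hJ ψ hψ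
  -- the (E6) family at level `T` (★ p864608)
  obtain ⟨Fam, hFd, hFam⟩ := hE6_midWitness L μ νG ν h𝓕N h𝓕c h𝓕₀ hβ hμZ hφV hφc hφM hK' hKinf U₀ hU₀o hU₀c hU hVc μa μf bV hbc hbM h2 hc hJ ψ hψ hT'
  -- (L2) of record on the basis `bV` of `V(χʷ, K′, ω)` (★ p864687 §1)
  obtain ⟨wc, Bc, hwc, hwagree, hBc1, hBc2, hBagree, hwcf, hBcf⟩ := exists_scalars_of_coords_global L μK νI 𝓕I ν h𝓕1 χ φ
    (fun j => ((bV j : ↥(chiSectionSpace (reflectChar (IsCMField.complexConj L) χ) K' ω)) : (quasiSplit (↥(maximalRealSubfield L)) L (IsCMField.complexConj L) 3).Adelic → ℂ))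
    hqφ hqcP hqcq hPc (fun j => integrable_restrict_mul_conj_of_bounded L μK (hbc j) hφc (hbM j) hφM)
    (fun j l => integrable_restrict_mul_conj_of_bounded L μK (hbc j) (hbc l) (hbM j) (hbM l))
  have hφ : IsChiSectionPair χ (1 : ↥(TorusDict.torus (IsCMField.complexConj L)) →ₜ* ℂˣ) φ :=
    IsChiSection.isChiSectionPair_of_trivial (one_apply_torus (IsCMField.complexConj L)) (isChiSection_of_mem hφV)
  have hχ₂u : ∀ u : ↥(TorusDict.torus (IsCMField.complexConj L)), ‖(((1 : ↥(TorusDict.torus (IsCMField.complexConj L)) →ₜ* ℂˣ) u : ℂˣ) : ℂ)‖ = 1 := fun u => by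
    rw [one_apply_torus]; simp
  -- THE EULER FACTORISATION (★ p864823) and ★ F4's `G`: `(z−2)(2z−3)·qc_j = G·a_j` on the connected `D = {1 < Re} ∖ P`
  obtain ⟨Gs, hGd, hGeq, -, -, -⟩ := exists_differentiableOn_mul_chiScalar_cm_three L hφL hφA hS hurφ hηu hηA hT hurη
  obtain ⟨a, ha, hqa'⟩ := exists_eulerFactorisation_midWitness L μ νG ν h𝓕N h𝓕c h𝓕₀ hβ hμZ hφV hφc hφM hK' hKinf U₀ hU₀o hU₀c hU hVc μa μf bV hbc hbM h2 hc hJ ψ hψ h𝓕1 hunfK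
  have hO : IsOpen {z : ℂ | 1 < z.re} := isOpen_lt continuous_const continuous_re
  have hDpc : IsPreconnected ({z : ℂ | 1 < z.re} \ midWitnessP L μ νG ν h𝓕N h𝓕c h𝓕₀ hβ hμZ hφV hφc hφM hK' hKinf U₀ hU₀o hU₀c hU hVc μa μf bV hbc hbM h2 hc hJ ψ hψ) :=
    isPreconnected_convex_diff_of_countable Literature.Topology.Euclidean.one_lt_rank_real_complex (convex_halfSpace_re_gt (1 : ℝ)) hO (countable_of_codiscrete hPcd)
  have h3 : (3 : ℂ) ∈ {z : ℂ | 1 < z.re} \ midWitnessP L μ νG ν h𝓕N h𝓕c h𝓕₀ hβ hμZ hφV hφc hφM hK' hKinf U₀ hU₀o hU₀c hU hVc μa μf bV hbc hbM h2 hc hJ ψ hψ := by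
    refine ⟨by norm_num, fun h => ?_⟩
    have h' := hPre _ h
    norm_num at h'
  have hEqOn : ∀ j, EqOn (fun z => (z - 2) * (2 * z - 3) * midWitnessQc L μ νG ν h𝓕N h𝓕c h𝓕₀ hβ hμZ hφV hφc hφM hK' hKinf U₀ hU₀o hU₀c hU hVc μa μf bV hbc hbM h2 hc hJ ψ hψ j z) (fun z => Gs z * a j z) ({z : ℂ | 1 < z.re} \ midWitnessP L μ νG ν h𝓕N h𝓕c h𝓕₀ hβ hμZ hφV hφc hφM hK' hKinf U₀ hU₀o hU₀c hU hVc μa μf bV hbc hbM h2 hc hJ ψ hψ) := by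
    intro j
    have hu : AnalyticOnNhd ℂ (fun z => (z - 2) * (2 * z - 3) * midWitnessQc L μ νG ν h𝓕N h𝓕c h𝓕₀ hβ hμZ hφV hφc hφM hK' hKinf U₀ hU₀o hU₀c hU hVc μa μf bV hbc hbM h2 hc hJ ψ hψ j z) ({z : ℂ | 1 < z.re} \ midWitnessP L μ νG ν h𝓕N h𝓕c h𝓕₀ hβ hμZ hφV hφc hφM hK' hKinf U₀ hU₀o hU₀c hU hVc μa μf bV hbc hbM h2 hc hJ ψ hψ) :=
      fun z hz => ((analyticAt_id.sub analyticAt_const).mul ((analyticAt_const.mul analyticAt_id).sub analyticAt_const)).mul (hqan j z hz.2)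
    have hv : AnalyticOnNhd ℂ (fun z => Gs z * a j z) ({z : ℂ | 1 < z.re} \ midWitnessP L μ νG ν h𝓕N h𝓕c h𝓕₀ hβ hμZ hφV hφc hφM hK' hKinf U₀ hU₀o hU₀c hU hVc μa μf bV hbc hbM h2 hc hJ ψ hψ) :=
      fun z hz => (hGd.analyticAt (hO.mem_nhds hz.1)).mul ((ha j).analyticAt (hO.mem_nhds hz.1))
    have heq : (fun z => (z - 2) * (2 * z - 3) * midWitnessQc L μ νG ν h𝓕N h𝓕c h𝓕₀ hβ hμZ hφV hφc hφM hK' hKinf U₀ hU₀o hU₀c hU hVc μa μf bV hbc hbM h2 hc hJ ψ hψ j z) =ᶠ[𝓝 (3 : ℂ)] fun z => Gs z * a j z := by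
      filter_upwards [hO.mem_nhds (show (3 : ℂ) ∈ {z : ℂ | 1 < z.re} by norm_num), (isOpen_lt continuous_const continuous_re).mem_nhds (show (3 : ℂ) ∈ {z : ℂ | 2 < z.re} by norm_num)]
        with z _ hz
      rw [hqcq j z hz, hqa' j z hz, ← hGeq z hz]
      ring
    exact hu.eqOn_of_preconnected_of_eventuallyEq hv hDpc h3 heq
  -- THE SIMPLE-POLE DATA AT `3∕2`: `dq_j := G·a_j∕(2(z−2))` is analytic at `3∕2` and equals `(z − 3∕2)·qc_j` on the punctured neighbourhood (inside `D`, off `2`)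
  have h32mem : ((3 : ℂ) / 2) ∈ {z : ℂ | 1 < z.re} := by norm_num
  have hDev : ∀ᶠ z in 𝓝[≠] ((3 : ℂ) / 2), (z ∈ {z : ℂ | 1 < z.re} \ midWitnessP L μ νG ν h𝓕N h𝓕c h𝓕₀ hβ hμZ hφV hφc hφM hK' hKinf U₀ hU₀o hU₀c hU hVc μa μf bV hbc hbM h2 hc hJ ψ hψ) ∧ z ≠ 2 := by
    filter_upwards [mem_nhdsWithin_of_mem_nhds (hO.mem_nhds h32mem), hPcd ((3 : ℂ) / 2),
      mem_nhdsWithin_of_mem_nhds (isOpen_ne.mem_nhds (show ((3 : ℂ) / 2) ≠ 2 by norm_num))] with z hz hzP hz2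
    exact ⟨⟨hz, hzP⟩, hz2⟩
  have hdq : ∀ j, AnalyticAt ℂ (fun z => Gs z * a j z / (2 * (z - 2))) ((3 : ℂ) / 2) := fun j =>
    ((hGd.analyticAt (hO.mem_nhds h32mem)).mul ((ha j).analyticAt (hO.mem_nhds h32mem))).div
      (analyticAt_const.mul (analyticAt_id.sub analyticAt_const)) (by norm_num)
  have hdqeq : ∀ j, ∀ᶠ z in 𝓝[≠] ((3 : ℂ) / 2), (fun z => Gs z * a j z / (2 * (z - 2))) z = (z - (3 : ℂ) / 2) * midWitnessQc L μ νG ν h𝓕N h𝓕c h𝓕₀ hβ hμZ hφV hφc hφM hK' hKinf U₀ hU₀o hU₀c hU hVc μa μf bV hbc hbM h2 hc hJ ψ hψ j z := fun j => by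
    filter_upwards [hDev] with z hz
    have hz2 : (z - 2 : ℂ) ≠ 0 := sub_ne_zero.2 hz.2
    have h := hEqOn j hz.1
    dsimp only at h ⊢
    rw [← h]
    field_simp
  obtain ⟨d, hd, hdw⟩ := exists_simplePole_of_coords_formula hdq hdqeq _ _ hwcf
  obtain ⟨B₀, hβ32⟩ := exists_sqPole_kernelDiag_of_coords hdq hdqeq _ _ hBcf
  -- AXIS REALITY on the punctured real trace of `3∕2` (★ p864973, letter-free; propagated by ★ `eventually_im_eq_zero_of_real_offPoles`)
  have hreal : ∀ᶠ x : ℝ in 𝓝[≠] (3 / 2 : ℝ), (wc (x : ℂ)).im = 0 :=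
    eventually_im_eq_zero_of_real_offPoles hPcd (fun x hx hxP => by
      rw [hwcf]; exact hreal_midWitness L μ νG ν h𝓕N h𝓕c h𝓕₀ hβ hμZ hφV hφc hφM hK' hKinf U₀ hU₀o hU₀c hU hVc μa μf bV hbc hbM h2 hc hJ ψ hψ μK νI h𝓕I h𝓕1 hχ₁ hρ₁ x hx hxP) (by norm_num)
  -- THE RELATION LETTER `hMSrel` near `3∕2`, letter-free: uniform tube constants (★ TUBE-FREE) + agreements, ★ `msRel_of_tube_letters_at` on the quarter-plane domains
  obtain ⟨⟨hD₁, hD₁c, hD₁sub, ⟨O₁, O₂', hO₁, hO₁ne, hO₁D, hO₂', hO₂'ne, hO₂'D, hsep⟩, -⟩, ⟨hD₂, hD₂c, hD₂sub, ⟨Q₁, Q₂', hQ₁, hQ₁ne, hQ₁D, hQ₂', hQ₂'ne, hQ₂'D, hsep₂⟩, -⟩⟩ :=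
    quarterDomains_of_codiscrete hPc hPcd one_lt_two
  obtain ⟨hD₁ev, hD₂ev⟩ := eventually_mem_quarterDomains_of_codiscrete hPcd h32mem
  have hFtube : ∀ D : Set ℂ, D ⊆ (midWitnessP L μ νG ν h𝓕N h𝓕c h𝓕₀ hβ hμZ hφV hφc hφM hK' hKinf U₀ hU₀o hU₀c hU hVc μa μf bV hbc hbM h2 hc hJ ψ hψ)ᶜ → ∀ z ∈ D, 2 < z.re → ((Fam z : Lp ℂ 2 μ) : (quasiSplit (↥(maximalRealSubfield L)) L (IsCMField.complexConj L) 3).automorphicQuotient → ℂ) =ᵐ[μ]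
      (quasiSplit (↥(maximalRealSubfield L)) L (IsCMField.complexConj L) 3).quotFun (truncation ν 𝓕 T' (eisensteinSeriesU (flatSectionU φ z))) := fun D hD z hz hz2 => by
    rw [← hE2 z hz2]; exact hFam z (hD hz)
  have hD₁P : ((({z : ℂ | 1 < z.re} ∩ {z : ℂ | 0 < z.im}) ∩ univ) \ midWitnessP L μ νG ν h𝓕N h𝓕c h𝓕₀ hβ hμZ hφV hφc hφM hK' hKinf U₀ hU₀o hU₀c hU hVc μa μf bV hbc hbM h2 hc hJ ψ hψ) ⊆ (midWitnessP L μ νG ν h𝓕N h𝓕c h𝓕₀ hβ hμZ hφV hφc hφM hK' hKinf U₀ hU₀o hU₀c hU hVc μa μf bV hbc hbM h2 hc hJ ψ hψ)ᶜ := fun z hz => hz.2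
  have hD₂P : ((({z : ℂ | 1 < z.re} ∩ {z : ℂ | z.im < 0}) ∩ univ) \ midWitnessP L μ νG ν h𝓕N h𝓕c h𝓕₀ hβ hμZ hφV hφc hφM hK' hKinf U₀ hU₀o hU₀c hU hVc μa μf bV hbc hbM h2 hc hJ ψ hψ) ⊆ (midWitnessP L μ νG ν h𝓕N h𝓕c h𝓕₀ hβ hμZ hφV hφc hφM hK' hKinf U₀ hU₀o hU₀c hU hVc μa μf bV hbc hbM h2 hc hJ ψ hψ)ᶜ := fun z hz => hz.2
  obtain ⟨Cμ, CK, hCμ, hCK, hU⟩ := chiTube_threeScalars_uniform_free L μ νG μK νI h𝓕I ν h𝓕N h𝓕1 h𝓕c hβ hT' hχ₁ hρ₁ hχ₂u (isAutomorphic_one (IsCMField.complexConj L)) hφc hφ hφM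
  have hMStube : ∀ {D : Set ℂ}, (∀ z ∈ D, 2 < z.re → ((Fam z : Lp ℂ 2 μ) : (quasiSplit (↥(maximalRealSubfield L)) L (IsCMField.complexConj L) 3).automorphicQuotient → ℂ) =ᵐ[μ] (quasiSplit (↥(maximalRealSubfield L)) L (IsCMField.complexConj L) 3).quotFun (truncation ν 𝓕 T' (eisensteinSeriesU (flatSectionU φ z)))) →
      ∀ z ∈ D, ∀ z' ∈ D, 2 < z'.re → z'.re < z.re →
      ⟪Fam z', Fam z⟫_ℂ = ((Cμ : ℝ) : ℂ) * (((CK : ℝ) : ℂ) *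
        ((((T' : ℝ) : ℂ) ^ (z + conj z' - 2) / (z + conj z' - 2)) * ((((∫ x in {x : (AdeleRing (𝓞 L) L)ˣ | (IdeleClassGroup.ideleNorm L x : ℝ) ≤ 1} ∩ 𝓕I, (IdeleClassGroup.ideleNorm L x : ℝ) ∂νI) * (∫ k, ‖φ (k : (quasiSplit (↥(maximalRealSubfield L)) L (IsCMField.complexConj L) 3).Adelic)‖ ^ 2 ∂μK)) : ℝ) : ℂ)
          + (((T' : ℝ) : ℂ) ^ (z - conj z') / (z - conj z')) * conj (wc z')
          - (((T' : ℝ) : ℂ) ^ (-(z - conj z')) / (z - conj z')) * wc z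
          - (((T' : ℝ) : ℂ) ^ (-(z + conj z' - 2)) / (z + conj z' - 2)) * Bc z z')) := by
    intro D hFt z hz z' hz' h1 h2
    rw [hU Fam hFt z hz z' hz' h1 h2, hwagree z (h1.trans h2), hwagree z' h1, hBagree z z' (h1.trans h2) h1]
  have hrel := msRel_of_tube_letters_at ((3 : ℂ) / 2) hD₁ hD₁c hD₁sub hO₁ hO₁ne hO₁D hO₂' hO₂'ne hO₂'D hsep hD₂ hD₂c hD₂sub hQ₁ hQ₁ne hQ₁D hQ₂' hQ₂'ne hQ₂'D hsep₂
    hD₁ev hD₂ev Cμ CK ((∫ x in {x : (AdeleRing (𝓞 L) L)ˣ | (IdeleClassGroup.ideleNorm L x : ℝ) ≤ 1} ∩ 𝓕I, (IdeleClassGroup.ideleNorm L x : ℝ) ∂νI) * (∫ k, ‖φ (k : (quasiSplit (↥(maximalRealSubfield L)) L (IsCMField.complexConj L) 3).Adelic)‖ ^ 2 ∂μK)) hT0 (hwc.mono hD₁P) (hwc.mono hD₂P) (fun z' _ => (hBc1 z').mono hD₁P) (fun z _ => (hBc2 z).mono fun u hu => hu.2)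
    (fun z' _ => (hBc1 z').mono hD₂P) (fun z _ => (hBc2 z).mono fun u hu => hu.2) Fam (hFd.mono hD₁P) (hFd.mono hD₂P) (hMStube (hFtube _ hD₁P)) (hMStube (hFtube _ hD₂P))
  -- ★ p863403 AT THE MIDDLE POLE, then `‖(z − 3∕2)•Fam z‖ = ‖z − 3∕2‖·‖Λ^T(midWitnessEc z)‖_{L²}` off `P`
  obtain ⟨C, hC⟩ := msBound_middlePole_of_chiRelation Fam hPc.isOpen_compl (hPcd _) hFd.continuousOn Cμ CK ((∫ x in {x : (AdeleRing (𝓞 L) L)ˣ | (IdeleClassGroup.ideleNorm L x : ℝ) ≤ 1} ∩ 𝓕I, (IdeleClassGroup.ideleNorm L x : ℝ) ∂νI) * (∫ k, ‖φ (k : (quasiSplit (↥(maximalRealSubfield L)) L (IsCMField.complexConj L) 3).Adelic)‖ ^ 2 ∂μK)) hT0 (β := fun z => Bc z z) hd hdw hreal ⟨B₀, hβ32⟩ hrel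
  refine ⟨C, ?_⟩
  filter_upwards [hC, hPcd ((3 : ℂ) / 2)] with z hz hzP
  rw [norm_smul, Lp.norm_def, eLpNorm_congr_ae (hFam z hzP)] at hz
  exact hz

end OfRecord

end Summit.HodgeConjecture.HodgeConjecture.Cruxes.H413.K2E1ChiMS32OfUnfoldingCMThree

end
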